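import Summits.CriticalPhenomena.SAWScalingLimit.Theses.SAWDefectDecoherence
import Summits.CriticalPhenomena.SAWScalingLimit.Theorems.ObservableToSLE.Negative.Identification

/-!
# Sketch — crux idea `bridge-point-germ-transfer` (crux stmt-CriticalPhenomena-14005, `ObservableToSLER`)

Ideator 3, round 1.  Typed vocabulary of the idea card:

* `RenewalFactorisation` — FIRST LEMMA (exact, provable now): a walk that crosses the edge
  boundary of a vertex set `S` exactly once factorises into a walk of `S` and a walk of `Λ ∖ S`,
  weights multiply (Kesten's bridge-point renewal, in any domain and for any cut set).
* `RenewalAccumulation` — the load-bearing a-priori input (RA): with probability `→ 1` the chordal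
  critical SAW crosses, EXACTLY ONCE and through a clean flat lattice window, the boundary of the
  inner component of some lattice hexagon around its starting point at a scale in `[r, √r]`
  (and likewise at its end point).
* `TwoPieceFloorIdentification` — what the picked restriction line delivers (identification of
  subsequential limits when BOTH marked points are flat-pinned, any of the six lattice half-plane
  orientations, floor-vertex endpoints); consumed, not proved, by this idea.
* `GermTransfer` — the transfer claim (W2 = `stub_domainExtension` of the picked line).
* `lineShape_holds` — the composition concludes the crux BY NAME.
-/

noncomputable section

open scoped BigOperators Topology NNReal ENNReal Classical
open Filter Set MeasureTheory Metric
open Literature.Probability.LatticeModels (HexVertex hexGraph hexCenter)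
open Literature.Probability.RandomPlanarGeometry
open Literature.Probability.RandomPlanarGeometry.SAW

namespace Summit.CriticalPhenomena.SAWScalingLimit.Cruxes.ObservableToSLER.BridgePointGermTransfer

open Summit.CriticalPhenomena.SAWScalingLimit.Theses

/-- The vertex list `l` makes a SINGLE TRANSITION out of `S` at index `m`, through the lattice
edge `{p, q}`: its first `m` vertices lie in `S` (the last of them is `p`), all later ones lie
outside `S` (the first of them is `q`). -/
def ListSingleTransition (S : Set HexVertex) (l : List HexVertex) (m : ℕ) (p q : HexVertex) :
    Prop :=
  (l.take m).getLast? = some p ∧ (l.drop m).head? = some q ∧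
    (∀ v ∈ l.take m, v ∈ S) ∧ (∀ v ∈ l.drop m, v ∉ S)

/-- **FIRST LEMMA — exact bridge-point (renewal) factorisation.**  For any vertex sets
`S ⊆ Λ`, any lattice edge `{p, q}` with `p ∈ S`, `q ∈ Λ ∖ S`, and mid-edges `a ≠ b` different
from `{p,q}`: the `x`-mass of the walks of `Λ` from `a` to `b` whose vertex list makes a single
transition out of `S` through `{p, q}` equals the product of the mass of walks of `S` from `a` to
the mid-edge `{p,q}` and the mass of walks of `Λ ∖ S` from `{p,q}` to `b` (concatenation is a
weight-preserving bijection: vertex sets are disjoint, the junction edge is `{p,q}`).  The SAW's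
exact renewal structure in ANY domain, for ANY cut set — Kesten's bridge points / Hammersley–Welsh,
Alberts–Duminil-Copin in the continuum. -/
def RenewalFactorisation : Prop :=
  ∀ (Λ S : Finset HexVertex) (a b : Sym2 HexVertex) (p q : HexVertex) (x : ℝ),
    S ⊆ Λ → p ∈ S → q ∈ Λ → q ∉ S → hexGraph.Adj p q → a ≠ b → a ≠ s(p, q) → b ≠ s(p, q) →
    (∑ γ : HexMidEdgeSAW Λ a b,
        (if ∃ m : ℕ, ListSingleTransition (↑S : Set HexVertex) γ.verts m p q
          then x ^ γ.length else 0)) =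
      (∑ γ₁ : HexMidEdgeSAW S a s(p, q), x ^ γ₁.length) *
        (∑ γ₂ : HexMidEdgeSAW (Λ \ S) s(p, q) b, x ^ γ₂.length)

/-! ### Lattice hexagons, inner components, clean flat windows -/

/-- The three zigzag "row coordinates" of a honeycomb vertex `v = (x, t)` (cell `x ∈ ℤ²`, triangle
type `t ∈ {0,1}`): horizontal rows `x 1` (the row function of `HexObservableLimitR`'s exact
half-lattice clause), `60°`-rows `x 0`, `120°`-rows `x 0 + x 1 + t` (the strip of `𝕋`-triangles
between consecutive lattice lines of each family). -/
def rowCoord (i : Fin 3) (v : HexVertex) : ℤ :=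
  if i = 0 then v.1 1 else if i = 1 then v.1 0 else v.1 0 + v.1 1 + (v.2 : ℕ)

/-- The lattice hexagon of size `n` around `c`: all three row coordinates within `n` of those of
`c` (its six sides are flat zigzag pieces in the three lattice directions). -/
def hexBall (c : HexVertex) (n : ℕ) : Set HexVertex :=
  {v | ∀ i : Fin 3, |rowCoord i v - rowCoord i c| ≤ n}

/-- The INNER COMPONENT `S_n(c)`: vertices of the discrete domain `Ω_δ` joined to `c` inside the
lattice hexagon of size `n` around `c` (component, not ball: robust to spiralling / re-entrant
domains). -/
def innerComponent (Ω : Set ℂ) (δ : ℝ) (c : HexVertex) (n : ℕ) : Set HexVertex :=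
  {v | v ∈ hexBall c n ∧ ∃ w : (hexDomainGraph Ω δ).Walk c v, ∀ y ∈ w.support, y ∈ hexBall c n}

/-- A CLEAN FLAT WINDOW of macroscopic radius `ρ` at the crossing edge `{p, q}` (`p ∈ S`, `q ∉ S`):
inside the Euclidean ball of radius `ρ` about `δ·q`, every honeycomb vertex is a vertex of `Ω_δ`,
and membership in `S` is EXACTLY a half-lattice condition in one of the three row families —
so the outer domain `Ω_δ ∖ S` is, near its new root `q`, an exact half-lattice above a flat
zigzag floor (the root clause of `HexObservableLimitR`, in one of six orientations; corners of
the hexagon and the boundary `∂Ω` are automatically `ρ`-far). -/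
def HasCleanWindow (Ω : Set ℂ) (δ ρ : ℝ) (S : Set HexVertex) (p q : HexVertex) : Prop :=
  ∃ (i : Fin 3) (σ : ℤ), (σ = 1 ∨ σ = -1) ∧ σ * (rowCoord i q - rowCoord i p) = 1 ∧
    ∀ x : HexVertex, ‖(δ : ℂ) * (hexCenter x - hexCenter q)‖ < ρ →
      x ∈ embMeshDomain hexGraph hexCenter Ω δ ∧ (x ∈ S ↔ σ * (rowCoord i x - rowCoord i p) ≤ 0)

/-- A GOOD RENEWAL of the vertex list `l` (read from the endpoint `c = l.head`) at scales in
`[r, √r]`: for some lattice size `n` with `r ≤ nδ ≤ √r`, `l` makes a single transition out of the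
inner component `S_n(c)` through an edge `{p,q}` carrying a clean flat window of radius `ρ`. -/
def GoodRenewalAt (Ω : Set ℂ) (δ r ρ : ℝ) (c : HexVertex) (l : List HexVertex) : Prop :=
  ∃ (n m : ℕ) (p q : HexVertex), r ≤ n * δ ∧ n * δ ≤ Real.sqrt r ∧
    ListSingleTransition (innerComponent Ω δ c n) l m p q ∧
    HasCleanWindow Ω δ ρ (innerComponent Ω δ c n) p q

/-- **RA — RENEWAL ACCUMULATION at both endpoints (the load-bearing a-priori input).**  For the
canonical critical hexagonal SAW law of any Dobrushin domain and any endpoint approximation: for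
every `ε > 0` there are a scale `r > 0` and a window radius `ρ > 0` such that, for all small
meshes, with probability `≥ 1 − ε` the walk has a good renewal at scales in `[r, √r]` around its
starting vertex AND (read backwards) around its end vertex.  Positive, exact-identity-based,
corridor-robust (a walk squeezed in a thin corridor renews at every scale); for floor/half-plane
germs it follows from the restriction line's own inputs via Kesten's `I(x_c) = 1` renewal and
Erickson/Dynkin–Lamperti bounds; the rough-germ case is the new content. -/
def RenewalAccumulation : Prop :=
  ∀ (D : DobrushinDomain) (a b : ℝ → HexVertex), IsEmbEndpointApprox hexGraph hexCenter D a b →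
    ∀ ε > (0 : ℝ), ∃ r > (0 : ℝ), ∃ ρ > (0 : ℝ), ∀ᶠ δ : ℝ in 𝓝[>] 0,
      hexSAWLaw D.carrier δ (a δ) (b δ)
          {γ | ¬ (GoodRenewalAt D.carrier δ r ρ (a δ) γ.walk.support ∧
                  GoodRenewalAt D.carrier δ r ρ (b δ) γ.walk.support.reverse)} ≤
        ENNReal.ofReal ε

/-! ### What the floor line delivers, and the transfer -/

/-- `D` is FLAT-PINNED at both marked points at radius `ρ`, in any of the six lattice half-plane
orientations: inside `B(pt i, ρ)` the domain is the open half-plane `{im(ū (z − pt i)) > 0}` for a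
sixth root of unity `u` (`u = 1`: the horizontal floor, domain above, of `HexObservableLimitR`). -/
def IsFlatPinned (D : DobrushinDomain) (ρ : ℝ) : Prop :=
  0 < ρ ∧ ∀ i : Fin 2, ∃ u : ℂ, u ^ 6 = 1 ∧
    D.carrier ∩ ball (D.pt i) ρ =
      {z : ℂ | 0 < ((starRingEnd ℂ) u * (z - D.pt i)).im} ∩ ball (D.pt i) ρ

/-- **Two-piece floor identification** (the OUTPUT of the picked restriction line, in the class
its mechanism naturally covers: coalescence/short-chord locality is used at the root only, so each
marked point needs its own flat piece, nothing global): for a Dobrushin domain flat-pinned at both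
marked points and endpoint approximations by mesh-boundary vertices, every probability
subsequential limit law of the canonical critical hexagonal SAW curves is the chordal SLE(8/3)
law. -/
def TwoPieceFloorIdentification : Prop :=
  ∀ (D : DobrushinDomain) (ρ : ℝ) (a b : ℝ → HexVertex), IsFlatPinned D ρ →
    IsEmbEndpointApprox hexGraph hexCenter D a b →
    (∀ᶠ δ : ℝ in 𝓝[>] 0,
      (∃ w : HexVertex, hexGraph.Adj (a δ) w ∧ (δ : ℂ) * hexCenter w ∉ D.carrier) ∧
      (∃ w : HexVertex, hexGraph.Adj (b δ) w ∧ (δ : ℂ) * hexCenter w ∉ D.carrier)) →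
    ∀ μ : Measure (CurveClass ℂ), IsProbabilityMeasure μ →
      IsSubseqLimitLaw (fun δ (γ : HexDomainSAW D.carrier δ (a δ) (b δ)) => γ.curve)
        (fun δ => hexSAWLaw D.carrier δ (a δ) (b δ)) μ →
      IsSLELaw ((8 : ℝ≥0) / 3) D μ

/-- Identification everywhere (verbatim the right-hand side of `observableToSLE_iff_identification`
after the two route hypotheses; = `FullIdentification` of the picked skeleton). -/
def FullIdentification : Prop :=
  ∀ (D : DobrushinDomain) (a b : ℝ → HexVertex),
    IsEmbEndpointApprox hexGraph hexCenter D a b →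
    ∀ μ : Measure (CurveClass ℂ), IsProbabilityMeasure μ →
      IsSubseqLimitLaw (fun δ (γ : HexDomainSAW D.carrier δ (a δ) (b δ)) => γ.curve)
        (fun δ => hexSAWLaw D.carrier δ (a δ) (b δ)) μ →
      IsSLELaw ((8 : ℝ≥0) / 3) D μ

/-- **THE TRANSFER (W2 = `stub_domainExtension` of the picked line, given a mechanism).**
Bridge points manufacture floors: on the good-renewal event, conditionally on the two end pieces
(diameter `≤ √r`), the middle piece is EXACTLY a chordal critical SAW of the outer lattice domain
between two flat-pinned lattice points with exact floating rows (`RenewalFactorisation` at the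
first renewal from each end), an admissible family of the fixed flat-pinned Jordan domain
`D ∖ (two hexagons)` after an `o(1)` lattice translation; `TwoPieceFloorIdentification`
identifies its limit, Radó/Carathéodory continuity of the SLE(8/3) law in the marked domain and
`r → 0` return `SLE(8/3)` in `(D; a, b)`; `HexTight` supplies the subsequential limits. -/
def GermTransfer : Prop :=
  TwoPieceFloorIdentification → RenewalAccumulation → SAWDefectDecoherence.HexTight →
    FullIdentification

/-- Shape of the line: floor line output + RA + transfer ⟹ the crux, by name. -/
def LineShape : Prop :=
  (SAWDefectDecoherence.HexObservableLimitR → SAWDefectDecoherence.HexTight →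
      TwoPieceFloorIdentification) →
    RenewalAccumulation → GermTransfer → SAWDefectDecoherence.ObservableToSLER

/-- The composition is pure logic through the landed `observableToSLE_iff_identification`
(the SAWDefectDecoherence copies of the crux and of its antecedents are `Iff.rfl`-identical to the
SAWDevelopingMap ones, cf. `Cruxes/ObservableToSLE/Disproof.lean`). -/
theorem lineShape_holds : LineShape := by
  intro hfloor hRA htr
  exact (Summit.CriticalPhenomena.SAWScalingLimit.Theorems.ObservableToSLE.Negative.observableToSLE_iff_identification).2
    (fun hO hT => htr (hfloor hO hT) hRA hT)

end Summit.CriticalPhenomena.SAWScalingLimit.Cruxes.ObservableToSLER.BridgePointGermTransfer
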